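import Summits.NavierStokesRegularity.OSWSelfSimilar.SheetRSpectrumPointEndToEnd
import Summits.NavierStokesRegularity.OSWSelfSimilar.SheetRCertificateAssemblyB
import Summits.NavierStokesRegularity.OSWSelfSimilar.SheetRProfileRegularity
import HarnessLib

/-!
# Sheet-ℝ spectral certificate (Z3-SR-SPEC): EXISTENCE ∘ SPECTRUM — the odd-class word about THE CERTIFIED PROFILE,
# modulo (S1), the Newton–Kantorovich row, implementation 2's point records, and nothing else

HONEST FRAMING (cell ns-blowup GROUP B «PROFILE SEARCH»; PROFILE-SPEC v1.3 cases Z3-SR-CERT + Z3-SR-SPEC; 1-D MODEL (viscous gCLM/OSW sheet on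
`ℝ` at `(a, c_l, ε) = (1/5, 1/2, 1)`); computer-assisted; not Euler/NS; «violates: none — MODEL»; census hook
`Literature.Analysis.FluidPDE.effectiveViscosity_half`). Nothing here is a statement about Navier–Stokes; NO enclosure and NO datum is proved here.
WHAT IT DOES (seat ns-blowup-profile-cert-2 g8; composition of tree theorems only). The end-to-end word of record
(`SheetRSpectrumPointEndToEnd.weakEigen_set_eq_singleton_of_pointData`, with cert-5's (P6)/(P8) chain inside) speaks about a profile `Ω*`
supplied by the caller through four hypotheses: a centre datum `hcs : IsCentre 8 Ω* Ω*₁ H*`, `Ω* = Ω̄ + prim (der u)` with `‖u‖_E ≤ rE♯₂`, the weak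
profile equation for `Ω*` against ALL `C_c^∞` tests, and `Ω*(X₀) ≠ 0`. This file DISCHARGES all four from the EXISTENCE ASSEMBLY of this seat's
lineage (cert-2 g6 `SheetRCertificateAssemblyB.existsUnique_weakSolutionB`: exactly one `δ` with `‖δ‖_E ≤ rEBR2 = 5.284e-6` whose profile solves the
LINEARISED weak equation at the centre, under the Newton–Kantorovich named hypotheses) — i.e. it proves them for `Ω* := Ω̄ + prim (der δ)` for ANY
`δ` in the `rEBR2`-ball solving that linearised weak equation:
* §1 `exists_isCentre_star`: such an `Ω*` is a CENTRE (`IsCentre 8 Ω* Ω*₁ H*` for an even `Ω*₁` with `Ω* = ∫₀Ω*₁` and some `H* ≥ |HΩ*|`), a weak zero of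
  the profile map against ALL tests, and `Ω*(X₀) ≠ 0` whenever `|Ω̄(X₀)| > (√2/8)·rEBR2` — by `profile_facts`, `residual_of_contDiff` +
  `weakZero_of_linearised_weak_eq` (g6: weak zero against ODD tests), `SheetRWeakZeroParity.exists_odd_representative` + `weakZero_of_odd_tests`
  (selfsim: even representative of `Ω*₁`, all tests), `timeShiftMode_eigen_and_energy_of_weakZero` (cert-5: `Ω* ∈ C³`) and
  `SheetRProfileRegularity.exists_bounds` (`|HΩ*| ≤ H*`);
* §2 `weakEigen_set_eq_singleton_certified` / `weakEigen_one_simple_certified`: the Z3-SR-SPEC odd-class word «{σ : Re σ > −3/100 ∧ −DG(Ω*)|odd has a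
  non-trivial weak eigenvector at σ} = {1}, σ = 1 simple» for THAT `Ω*`, modulo EXACTLY: the centre datum `hc` + `Ω̄₁ ∈ C¹` + the weighted
  square-integrability of the centre residual (`hG`), the linearised weak equation in the `rEBR2`-ball (= the OUTPUT of `existsUnique_weakSolutionB`,
  whose own hypotheses are the (C1) pointwise datum and the `KNwB`/`epsNBR`/`etaB2` literals), `|Ω̄(X₀)| > (√2/8)·rEBR2`, the (S1) Gårding datum at
  the centre, and implementation 2's 19 point records + far record + `‖h‖²_w ≤ hw2`.
WHAT THIS IS NOT: not NS; no number of record moves; `rEBR2 ≤ rE♯₂` is the only literal inequality closed here.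
-/

noncomputable section

namespace Summit.NavierStokesRegularity.OSWSelfSimilar
namespace SheetRSpectrumCertifiedProfile

open _root_.MeasureTheory _root_.Set _root_.Filter _root_.Real _root_.Metric Literature.Analysis.Fourier SheetRWeakProfilePV SheetRWeakToStrong
  SheetREnergyClass SheetRWeightedMeasure SheetREnergySpace SheetRLinearisedTests SheetRTestSpace SheetRLinearisedFormBounds
  SheetRSolutionOperator SheetRComplexPivot SheetRAssemblyOperators SheetRCertificateAssembly SheetRGeneratorOddWeak SheetROddClass
  SheetRResolventOddClass SheetREvansOdd SheetRSpectrumWindingLists SheetRSpectrumOddAssembly SheetRSpectrumOddAssemblyReal SheetRWeakEigenReal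
  SheetRPerturbedResolventC SheetRLinearisationPerturbation SheetRTimeShiftModeWeak SheetRTimeShiftModeWeakEigen SheetRCentreReencoding
  SheetRSpectrumStepRule SheetRSpectrumPointCertificate SheetRResolventConj SheetRSpectrumPointAssembly SheetRSpectrumEndToEnd
  SheetRSpectrumPointEndToEnd SheetRCertificateWeakZero SheetRCertificateCoercivity SheetRCertificateAssemblyB
  Literature.Analysis.OperatorTheory Complex CertificateViscousSheetR
open scoped Topology ENNReal InnerProductSpace ContDiff

/-- Weighted square-integrability of a sum. [folklore] -/
theorem integrable_weight_sq_add {L : ℝ} {f g : ℝ → ℝ} (hfm : AEStronglyMeasurable f volume) (hgm : AEStronglyMeasurable g volume)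
    (hf : Integrable fun y => (L ^ 2 + y ^ 2) * f y ^ 2) (hg : Integrable fun y => (L ^ 2 + y ^ 2) * g y ^ 2) :
    Integrable fun y => (L ^ 2 + y ^ 2) * (f y + g y) ^ 2 := by
  have hm : AEStronglyMeasurable (fun y => (L ^ 2 + y ^ 2) * (f y + g y) ^ 2) volume :=
    ((continuous_const.add (continuous_id.pow 2)).aestronglyMeasurable).mul ((hfm.add hgm).pow 2)
  refine ((hf.add hg).const_mul 2).mono' hm (Eventually.of_forall fun y => ?_)
  have hw : 0 ≤ L ^ 2 + y ^ 2 := by positivity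
  rw [Real.norm_eq_abs, abs_of_nonneg (by positivity), Pi.add_apply]
  nlinarith [sq_nonneg (f y - g y), mul_nonneg hw (sq_nonneg (f y - g y))]

section Star

variable {Ω Ω₁ : ℝ → ℝ} {H₀ : ℝ} (hc : IsCentre 8 Ω Ω₁ H₀) (hΩ₁ : ContDiff ℝ 1 Ω₁)
  (hG : Integrable fun y => ((8:ℝ) ^ 2 + y ^ 2) * (Ω y + 1 / 2 * y * Ω₁ y + 1 / 5 * (∫ s in (0 : ℝ)..y, hilbertTransform Ω s) * Ω₁ y
    - hilbertTransform Ω y * Ω y - deriv Ω₁ y) ^ 2)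
  (δ : Esp 8 eight_pos) (hball : δ ∈ closedBall (0 : Esp 8 eight_pos) (rEBR2 : ℝ))
  (hlin : ∀ v v₁ : ℝ → ℝ, IsCompactTest v v₁ →
    linForm 8 (drift (1 / 5) Ω) (potential 8 4 Ω) (prim (der δ)) (der δ) v v₁ =
      ∫ y, ((8:ℝ) ^ 2 + y ^ 2) * ((PopFun 8 4 (1 / 5) Ω Ω₁ δ y
        - (Ω y + 1 / 2 * y * Ω₁ y + 1 / 5 * (∫ s in (0 : ℝ)..y, hilbertTransform Ω s) * Ω₁ y - hilbertTransform Ω y * Ω y - deriv Ω₁ y)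
        - QFun 8 (1 / 5) δ δ y) * v y))
  {X₀ : ℝ} (hX₀ : Real.sqrt 2 / 8 * (rEBR2 : ℝ) < |Ω X₀|)

include hc hΩ₁ hG hball hlin hX₀ in
/-- **THE CERTIFIED PROFILE IS A CENTRE, A WEAK ZERO AGAINST ALL TESTS, AND NON-ZERO AT `X₀`.** For every `δ` in the `rEBR2`-ball solving the
linearised weak equation at the centre (the output of `existsUnique_weakSolutionB`): `Ω* := Ω̄ + prim (der δ)` admits an EVEN `Ω*₁` with
`Ω* = ∫₀Ω*₁` and an `H*` with `IsCentre 8 Ω* Ω*₁ H*`; it solves the weak profile equation (a = 1/5, ν = 1) against ALL `C_c^∞` tests; and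
`Ω*(X₀) ≠ 0` if `|Ω̄(X₀)| > (√2/8)·rEBR2`. [folklore] -/
theorem exists_isCentre_star :
    ∃ (Ωs₁ : ℝ → ℝ) (Hs : ℝ), IsCentre 8 (fun y => Ω y + prim (der δ) y) Ωs₁ Hs ∧
      (∀ ψ : ℝ → ℝ, ContDiff ℝ ∞ ψ → HasCompactSupport ψ →
        (∫ x, ((Ω x + prim (der δ) x) + 1 / 2 * x * Ωs₁ x
            + 1 / 5 * (∫ s in (0 : ℝ)..x, hilbertTransform (fun y => Ω y + prim (der δ) y) s) * Ωs₁ x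
            - hilbertTransform (fun y => Ω y + prim (der δ) y) x * (Ω x + prim (der δ) x)) * ψ x)
          + ∫ x, Ωs₁ x * deriv ψ x = 0) ∧
      (Ω X₀ + prim (der δ) X₀ ≠ 0) := by
  have h8 : (0 : ℝ) < 8 := eight_pos
  set Ωs : ℝ → ℝ := fun y => Ω y + prim (der δ) y with hΩs
  -- g6's profile facts and the weak zero against odd tests
  obtain ⟨hcont, hodd, hint, hL2, hΩ₁2, hwd, hsup⟩ := profile_facts hc δ
  obtain ⟨hGc, hres⟩ := residual_of_contDiff eight_pos (1 / 5) hc hΩ₁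
  obtain ⟨hg₀ae, -⟩ := norm_toLp_W eight_pos (memLp_W (L := 8) hGc.aestronglyMeasurable hG)
  have hW := weakZero_of_linearised_weak_eq hc hg₀ae hres hlin
  -- even representative of `Ω*₁`, fixed pointwise, and the equation against all tests
  obtain ⟨Ω', Ω₁', hae, hae₁, hΩ'odd, hΩ₁'e, hprim, hΩ₁'2, hΩ'i, hΩ'2, hH⟩ :=
    SheetRWeakZeroParity.exists_odd_representative hint hL2 hΩ₁2 (Eventually.of_forall hodd) hwd
  have hΩ'c : Continuous Ω' := continuous_of_primitive hprim (intervalIntegrable_of_memLp_two hΩ₁'2)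
  have heq : Ω' = Ωs := (Continuous.ae_eq_iff_eq volume hΩ'c hcont).1 hae
  subst heq
  have hweak' : ∀ ψ : ℝ → ℝ, ContDiff ℝ ∞ ψ → HasCompactSupport ψ → (∀ y, ψ (-y) = -ψ y) →
      (∫ x, (Ωs x + 1 / 2 * x * Ω₁' x + 1 / 5 * (∫ s in (0 : ℝ)..x, hilbertTransform Ωs s) * Ω₁' x
        - hilbertTransform Ωs x * Ωs x) * ψ x) + 1 * ∫ x, Ω₁' x * deriv ψ x = 0 := by
    intro ψ hψ hψc hψo
    have e1 : ∫ x, (Ωs x + 1 / 2 * x * Ω₁' x + 1 / 5 * (∫ s in (0 : ℝ)..x, hilbertTransform Ωs s) * Ω₁' x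
        - hilbertTransform Ωs x * Ωs x) * ψ x = ∫ x, (Ωs x + 1 / 2 * x * (Ω₁ x + der δ x)
        + 1 / 5 * (∫ s in (0 : ℝ)..x, hilbertTransform Ωs s) * (Ω₁ x + der δ x) - hilbertTransform Ωs x * Ωs x) * ψ x := by
      refine integral_congr_ae ?_
      filter_upwards [hae₁] with x hx₁
      simp only [hx₁]
    have e2 : ∫ x, Ω₁' x * deriv ψ x = ∫ x, (Ω₁ x + der δ x) * deriv ψ x :=
      integral_congr_ae (hae₁.mono fun x hx => by simp only [hx])
    rw [e1, e2]
    exact hW ψ hψ hψc hψo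
  have hall := SheetRWeakZeroParity.weakZero_of_odd_tests hΩ'odd hΩ₁'e hprim hΩ₁'2 hΩ'i hΩ'2 hweak'
  -- primitive form through the origin, weights, `C³`, and `Ω*₁ = Ω*′` a.e.
  have h0 : Ωs 0 = 0 := by have := hΩ'odd 0; rw [neg_zero] at this; linarith
  have hprim0 : ∀ x, Ωs x = ∫ s in (0 : ℝ)..x, Ω₁' s := fun x => by rw [hprim x, h0, zero_add]
  obtain ⟨-, -, hΩ₁m, hwu, hwu₁, -⟩ := profile_of_mem eight_pos δ
  have hwΩ : Integrable fun y => ((8:ℝ) ^ 2 + y ^ 2) * Ωs y ^ 2 :=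
    integrable_weight_sq_add (hc.basic h8).1.aestronglyMeasurable (continuous_prim h8 _).aestronglyMeasurable hc.weight₀ hwu
  have hwΩ₁ : Integrable fun y => ((8:ℝ) ^ 2 + y ^ 2) * Ω₁' y ^ 2 := by
    have h1 : Integrable fun y => ((8:ℝ) ^ 2 + y ^ 2) * (Ω₁ y + der δ y) ^ 2 :=
      integrable_weight_sq_add hc.measurable hΩ₁m hc.weight₁ hwu₁
    refine h1.congr ?_
    filter_upwards [hae₁] with y hy
    rw [hy]
  obtain ⟨⟨hC3, -⟩, -⟩ := SheetRTimeShiftModeAssembly.timeShiftMode_eigen_and_energy_of_weakZero (a := 1 / 5) (L := 8) (ν := 1)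
    h8 one_pos hprim0 hΩ'odd hΩ₁'2.1 hwΩ hwΩ₁ hall rfl
  have hC2 : ContDiff ℝ 2 Ωs := hC3.of_le (by norm_num)
  have hC1 : ContDiff ℝ 1 Ωs := hC3.of_le (by norm_num)
  have haed : Ω₁' =ᵐ[volume] deriv Ωs := by
    filter_upwards [_root_.LocallyIntegrable.ae_hasDerivAt_integral (hΩ₁'2.locallyIntegrable one_le_two)] with y hy
    have e : Ωs = fun x => ∫ s in (0 : ℝ)..x, Ω₁' s := funext hprim0
    have h1 : HasDerivAt Ωs (Ω₁' y) y := by rw [e]; exact hy 0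
    exact h1.unique (((hC1.differentiable one_ne_zero) y).hasDerivAt)
  have hw1 : Integrable fun y => ((8:ℝ) ^ 2 + y ^ 2) * deriv Ωs y ^ 2 := by
    refine hwΩ₁.congr ?_
    filter_upwards [haed] with y hy
    rw [hy]
  -- the Hilbert bound and the centre structure
  obtain ⟨-, B, -, -, hB, -⟩ := SheetRProfileRegularity.exists_bounds h8 hC2 hΩ'odd hwΩ hw1
  have hall' : ∀ ψ : ℝ → ℝ, ContDiff ℝ ∞ ψ → HasCompactSupport ψ →
      (∫ x, (Ωs x + 1 / 2 * x * Ω₁' x + 1 / 5 * (∫ s in (0 : ℝ)..x, hilbertTransform Ωs s) * Ω₁' x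
        - hilbertTransform Ωs x * Ωs x) * ψ x) + ∫ x, Ω₁' x * deriv ψ x = 0 := fun ψ hψ hψc => by
    have h := hall ψ hψ hψc
    rwa [one_mul] at h
  -- `Ω*(X₀) ≠ 0`
  have hne : Ωs X₀ ≠ 0 := by
    intro hX
    have hδn : ‖δ‖ ≤ (rEBR2 : ℝ) := by rwa [mem_closedBall, dist_zero_right] at hball
    have h1 : |Ω X₀| ≤ Real.sqrt 2 / 8 * ‖δ‖ := by
      have e : Ω X₀ = -prim (der δ) X₀ := by
        have : Ω X₀ + prim (der δ) X₀ = 0 := hX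
        linarith
      rw [e, abs_neg]; exact hsup X₀
    have h2 : Real.sqrt 2 / 8 * ‖δ‖ ≤ Real.sqrt 2 / 8 * (rEBR2 : ℝ) := mul_le_mul_of_nonneg_left hδn (by positivity)
    linarith
  exact ⟨Ω₁', B, ⟨hprim0, hΩ'odd, hΩ₁'2.1, hwΩ, hwΩ₁, hB⟩, hall', hne⟩

end Star

/-! ### §2 The word about the certified profile -/

section Word

variable {Ω Ω₁ : ℝ → ℝ} {H₀ : ℝ} (hc : IsCentre 8 Ω Ω₁ H₀) (hΩ₁ : ContDiff ℝ 1 Ω₁)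
  (hG : Integrable fun y => ((8:ℝ) ^ 2 + y ^ 2) * (Ω y + 1 / 2 * y * Ω₁ y + 1 / 5 * (∫ s in (0 : ℝ)..y, hilbertTransform Ω s) * Ω₁ y
    - hilbertTransform Ω y * Ω y - deriv Ω₁ y) ^ 2)
  (δ : Esp 8 eight_pos) (hball : δ ∈ closedBall (0 : Esp 8 eight_pos) (rEBR2 : ℝ))
  (hlin : ∀ v v₁ : ℝ → ℝ, IsCompactTest v v₁ →
    linForm 8 (drift (1 / 5) Ω) (potential 8 4 Ω) (prim (der δ)) (der δ) v v₁ =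
      ∫ y, ((8:ℝ) ^ 2 + y ^ 2) * ((PopFun 8 4 (1 / 5) Ω Ω₁ δ y
        - (Ω y + 1 / 2 * y * Ω₁ y + 1 / 5 * (∫ s in (0 : ℝ)..y, hilbertTransform Ω s) * Ω₁ y - hilbertTransform Ω y * Ω y - deriv Ω₁ y)
        - QFun 8 (1 / 5) δ δ y) * v y))
  {X₀ : ℝ} (hX₀ : Real.sqrt 2 / 8 * (rEBR2 : ℝ) < |Ω X₀|)
  (hR : W 8) (hh : hR ∈ Wodd 8) {D₀ D₁ V₀ : ℝ}
  (hS1 : GardingDataKC 8 eight_pos (drift (1 / 5) Ω) (potential 8 4 Ω)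
    (-PopC eight_pos 4 (1 / 5) hc + ((4 : ℝ) • ((innerSL ℝ hR).comp (ιE eight_pos))).smulRight hR) D₀ D₁ V₀ (1 / 5) (3 / 20))
  (hPD : PointData (resolventKC eight_pos _ hS1) (ofRealW 8 hR) (ofRealW 8 hR) 4
    (evansOdd eight_pos _ hS1 ((innerSL ℂ (ofRealW 8 hR)).comp (Wcodd 8).subtypeL) (realOdd hR hh) 4))
  (hFD : MixedFarDatum (resolventKC eight_pos _ hS1) (ofRealW 8 hR) (ofRealW 8 hR) 1 ((3593635617 : ℝ) / 5000000000)
    ((331182857 : ℝ) / 250000000) ((802337581 : ℝ) / 500000000) ((1710547133 : ℝ) / 1000000000))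
  (hhw : ‖ofRealW 8 hR‖ ^ 2 ≤ ((CertificateViscousSheetRSpectrum.hw2 : ℚ) : ℝ))

/-- The location ball of the existence row sits inside the (P8) radius: `rEBR2 = 5.284e-6 ≤ rE♯₂ = 6.80e-6`. [folklore] -/
theorem rEBR2_le_rEsharp2 : ((rEBR2 : ℚ) : ℝ) ≤ ((CertificateViscousSheetR.rEsharp2 : ℚ) : ℝ) := by
  norm_num [rEBR2, CertificateViscousSheetR.rEsharp2]

include hΩ₁ hG hball hlin hX₀ hPD hFD hhw in
/-- **THE Z3-SR-SPEC ODD-CLASS WORD ABOUT THE CERTIFIED PROFILE.** For every `δ` in the `rEBR2`-ball solving the linearised weak equation at the centre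
(there is exactly one: `SheetRCertificateAssemblyB.existsUnique_weakSolutionB`, from the (C1) datum and the `KNwB`/`epsNBR`/`etaB2` literals), the profile
`Ω* = Ω̄ + prim (der δ)` IS a centre (`IsCentre 8 Ω* Ω*₁ H*` for some even `Ω*₁`, `H*`), and for the odd-class linearisation AT `Ω*` (the `Ω*`
encoding `(drift (1/5) Ω*, potential 8 4 Ω*, −PopC* + 4⟪h_R, ·⟫h_R)`): «{σ : Re σ > −3/100 ∧ there is a non-trivial weak eigenvector at σ} = {1}» —
modulo the (S1) Gårding datum at the centre, implementation 2's point records + far record + `‖h‖²_w ≤ hw2`, and `|Ω̄(X₀)| > (√2/8)·rEBR2`. In the cell's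
dictionary: «σ_p(−DG(Ω*)|odd) ∩ {Re σ > −3/100} = {1} for THE certified sheet profile». MODEL statement; not NS. [folklore] -/
theorem weakEigen_set_eq_singleton_certified :
    ∃ (Ωs₁ : ℝ → ℝ) (Hs : ℝ) (hcs : IsCentre 8 (fun y => Ω y + prim (der δ) y) Ωs₁ Hs),
      {σ : ℂ | ra < σ.re ∧ ∃ w : Wcodd 8, w ≠ 0 ∧
        IsWeakEigen eight_pos (-PopC eight_pos 4 (1 / 5) hcs + ((4 : ℝ) • ((innerSL ℝ hR).comp (ιE eight_pos))).smulRight hR)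
          (drift (1 / 5) (fun y => Ω y + prim (der δ) y)) (potential 8 4 (fun y => Ω y + prim (der δ) y))
          ((innerSL ℂ (ofRealW 8 hR)).comp (Wcodd 8).subtypeL) (realOdd hR hh) 4 σ w} = {1} := by
  obtain ⟨Ωs₁, Hs, hcs, hweak, hne⟩ := exists_isCentre_star hc hΩ₁ hG δ hball hlin hX₀
  have hδn : ‖δ‖ ≤ (rEBR2 : ℝ) := by rwa [mem_closedBall, dist_zero_right] at hball
  have hu : ‖δ‖ ≤ (CertificateViscousSheetR.rEsharp2 : ℝ) := hδn.trans rEBR2_le_rEsharp2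
  exact ⟨Ωs₁, Hs, hcs, weakEigen_set_eq_singleton_of_pointData hc hcs δ (fun _ => rfl) hR hh hS1 hu hPD hFD hhw hweak hne⟩

include hΩ₁ hG hball hlin hX₀ hPD hFD hhw in
/-- **… and `σ = 1` is simple for THE certified profile** (same hypotheses): for the same centre structure, `R_{K*}(1)(h_R + 0i) ≠ 0`, the weak
eigenvectors at `σ = 1` are exactly its multiples, and no weak Jordan chain exists over a non-zero eigenvector. MODEL statement; not NS. [folklore] -/
theorem weakEigen_one_simple_certified :
    ∃ (Ωs₁ : ℝ → ℝ) (Hs : ℝ) (hcs : IsCentre 8 (fun y => Ω y + prim (der δ) y) Ωs₁ Hs)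
      (hu : ‖δ‖ ≤ (CertificateViscousSheetR.rEsharp2 : ℝ)),
      resolventOdd eight_pos _ (gardingDataKC_star_of_centre 4 hc hcs δ (fun _ => rfl) hR hR 4 hS1 hu Llip_mul_rEsharp2_lt) 1
          (realOdd hR hh) ≠ 0 ∧
      (∀ w : Wcodd 8,
        IsWeakEigen eight_pos (-PopC eight_pos 4 (1 / 5) hcs + ((4 : ℝ) • ((innerSL ℝ hR).comp (ιE eight_pos))).smulRight hR)
            (drift (1 / 5) (fun y => Ω y + prim (der δ) y)) (potential 8 4 (fun y => Ω y + prim (der δ) y))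
            ((innerSL ℂ (ofRealW 8 hR)).comp (Wcodd 8).subtypeL) (realOdd hR hh) 4 1 w ↔
          ∃ t : ℂ, w = t • resolventOdd eight_pos _
            (gardingDataKC_star_of_centre 4 hc hcs δ (fun _ => rfl) hR hR 4 hS1 hu Llip_mul_rEsharp2_lt) 1 (realOdd hR hh)) ∧
      ∀ δ₀ : Wcodd 8, δ₀ ≠ 0 →
        IsWeakEigen eight_pos (-PopC eight_pos 4 (1 / 5) hcs + ((4 : ℝ) • ((innerSL ℝ hR).comp (ιE eight_pos))).smulRight hR)
            (drift (1 / 5) (fun y => Ω y + prim (der δ) y)) (potential 8 4 (fun y => Ω y + prim (der δ) y))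
            ((innerSL ℂ (ofRealW 8 hR)).comp (Wcodd 8).subtypeL) (realOdd hR hh) 4 1 δ₀ →
          ¬ ∃ δ₁ : Wcodd 8,
            IsWeakJordan eight_pos (-PopC eight_pos 4 (1 / 5) hcs + ((4 : ℝ) • ((innerSL ℝ hR).comp (ιE eight_pos))).smulRight hR)
              (drift (1 / 5) (fun y => Ω y + prim (der δ) y)) (potential 8 4 (fun y => Ω y + prim (der δ) y))
              ((innerSL ℂ (ofRealW 8 hR)).comp (Wcodd 8).subtypeL) (realOdd hR hh) 4 1 δ₀ δ₁ := by
  obtain ⟨Ωs₁, Hs, hcs, hweak, hne⟩ := exists_isCentre_star hc hΩ₁ hG δ hball hlin hX₀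
  have hδn : ‖δ‖ ≤ (rEBR2 : ℝ) := by rwa [mem_closedBall, dist_zero_right] at hball
  have hu : ‖δ‖ ≤ (CertificateViscousSheetR.rEsharp2 : ℝ) := hδn.trans rEBR2_le_rEsharp2
  exact ⟨Ωs₁, Hs, hcs, hu, weakEigen_one_simple_of_pointData hc hcs δ (fun _ => rfl) hR hh hS1 hu hPD hFD hhw hweak hne⟩

end Word

/-! ### §3 (APPEND) The word packaged with the existence row itself -/

section Packaged

open Matrix Finset
open scoped BigOperators

variable {Ω Ω₁ : ℝ → ℝ} {H₀ : ℝ} (hc : IsCentre 8 Ω Ω₁ H₀) (hΩ₁ : ContDiff ℝ 1 Ω₁)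
  (hC1 : ∀ ξ, ((8:ℝ) ^ 2 + ξ ^ 2) / 2 + 1 + ξ ^ 2 / 2 + 1 / 5 * ξ * (∫ s in (0 : ℝ)..ξ, hilbertTransform Ω s)
    + (1 / 5) / 2 * ((8:ℝ) ^ 2 + ξ ^ 2) * hilbertTransform Ω ξ ≤ ((8:ℝ) ^ 2 + ξ ^ 2) * potential 8 4 Ω ξ)
  (S₀ : W 8 →L[ℝ] Esp 8 eight_pos)
  (hS₀ : ∀ (g : W 8) (v v₁ : ℝ → ℝ), IsCompactTest v v₁ →
    linForm 8 (drift (1 / 5) Ω) (potential 8 4 Ω) (prim (der (S₀ g))) (der (S₀ g)) v v₁ = ∫ y, ((8:ℝ) ^ 2 + y ^ 2) * ((g : ℝ → ℝ) y * v y))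
  {n : ℕ} (f : Fin n → W 8) (ℓ : Fin n → Esp 8 eight_pos →L[ℝ] ℝ) (Nmat : Matrix (Fin n) (Fin n) ℝ)
  (hN₁ : (1 - capMatrix (fun i => S₀ (f i)) ℓ) * Nmat = 1) (hN₂ : Nmat * (1 - capMatrix (fun i => S₀ (f i)) ℓ) = 1)
  (hKNwB : ∀ g : W 8, ‖capInverse (fun i => S₀ (f i)) ℓ Nmat (S₀ g)‖ ≤ (KNwB : ℝ) * ‖g‖)
  (hepsNB : ∀ u : Esp 8 eight_pos, ‖PopC eight_pos 4 (1 / 5) hc u - ∑ i, ℓ i u • f i‖ ≤ (epsNBR : ℝ) * ‖u‖)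
  (hG : Integrable fun y => ((8:ℝ) ^ 2 + y ^ 2) * (Ω y + 1 / 2 * y * Ω₁ y + 1 / 5 * (∫ s in (0 : ℝ)..y, hilbertTransform Ω s) * Ω₁ y
    - hilbertTransform Ω y * Ω y - deriv Ω₁ y) ^ 2)
  (hηB : Real.sqrt (∫ y, ((8:ℝ) ^ 2 + y ^ 2) * (Ω y + 1 / 2 * y * Ω₁ y + 1 / 5 * (∫ s in (0 : ℝ)..y, hilbertTransform Ω s) * Ω₁ y
    - hilbertTransform Ω y * Ω y - deriv Ω₁ y) ^ 2) ≤ (etaB2 : ℝ))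
  {X₀ : ℝ} (hX₀ : Real.sqrt 2 / 8 * (rEBR2 : ℝ) < |Ω X₀|)
  (hR : W 8) (hh : hR ∈ Wodd 8) {D₀ D₁ V₀ : ℝ}
  (hS1 : GardingDataKC 8 eight_pos (drift (1 / 5) Ω) (potential 8 4 Ω)
    (-PopC eight_pos 4 (1 / 5) hc + ((4 : ℝ) • ((innerSL ℝ hR).comp (ιE eight_pos))).smulRight hR) D₀ D₁ V₀ (1 / 5) (3 / 20))
  (hPD : PointData (resolventKC eight_pos _ hS1) (ofRealW 8 hR) (ofRealW 8 hR) 4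
    (evansOdd eight_pos _ hS1 ((innerSL ℂ (ofRealW 8 hR)).comp (Wcodd 8).subtypeL) (realOdd hR hh) 4))
  (hFD : MixedFarDatum (resolventKC eight_pos _ hS1) (ofRealW 8 hR) (ofRealW 8 hR) 1 ((3593635617 : ℝ) / 5000000000)
    ((331182857 : ℝ) / 250000000) ((802337581 : ℝ) / 500000000) ((1710547133 : ℝ) / 1000000000))
  (hhw : ‖ofRealW 8 hR‖ ^ 2 ≤ ((CertificateViscousSheetRSpectrum.hw2 : ℚ) : ℝ))

include hΩ₁ hC1 hS₀ hN₁ hN₂ hKNwB hepsNB hG hηB hX₀ hPD hFD hhw in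
/-- **EXISTENCE ∘ SPECTRUM, PACKAGED.** Under the Newton–Kantorovich row's named hypotheses (cert-2 g6 `SheetRCertificateAssemblyB`, implementation 2's
constants: the (C1) pointwise datum, the solution operator `S₀` of the base form, the capacitance inverse `Nmat` with the `KNwB`/`epsNBR` bounds, the
residual bound `etaB2`), the (S1) Gårding datum at the centre, implementation 2's point records + far record + `‖h‖²_w ≤ hw2`, and
`|Ω̄(X₀)| > (√2/8)·rEBR2`: there is EXACTLY ONE `δ` in the `rEBR2`-ball whose profile solves the linearised weak equation at `Ω̄`, and for the profile
`Ω* = Ω̄ + prim (der δ)` — a centre — the odd-class Z3-SR-SPEC word holds: «{σ : Re σ > −3/100 ∧ −DG(Ω*)|odd has a non-trivial weak eigenvector at σ}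
= {1}». Everything between the named interval/NK sentences and the word is kernel. MODEL statement; not NS. [folklore] -/
theorem certifiedProfile_word :
    ∃ δ : Esp 8 eight_pos, δ ∈ closedBall (0 : Esp 8 eight_pos) (rEBR2 : ℝ) ∧
      (∀ v v₁ : ℝ → ℝ, IsCompactTest v v₁ →
        linForm 8 (drift (1 / 5) Ω) (potential 8 4 Ω) (prim (der δ)) (der δ) v v₁ =
          ∫ y, ((8:ℝ) ^ 2 + y ^ 2) * ((PopFun 8 4 (1 / 5) Ω Ω₁ δ y
            - (Ω y + 1 / 2 * y * Ω₁ y + 1 / 5 * (∫ s in (0 : ℝ)..y, hilbertTransform Ω s) * Ω₁ y - hilbertTransform Ω y * Ω y - deriv Ω₁ y)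
            - QFun 8 (1 / 5) δ δ y) * v y)) ∧
      (∀ δ' ∈ closedBall (0 : Esp 8 eight_pos) (rEBR2 : ℝ),
        (∀ v v₁ : ℝ → ℝ, IsCompactTest v v₁ →
          linForm 8 (drift (1 / 5) Ω) (potential 8 4 Ω) (prim (der δ')) (der δ') v v₁ =
            ∫ y, ((8:ℝ) ^ 2 + y ^ 2) * ((PopFun 8 4 (1 / 5) Ω Ω₁ δ' y
              - (Ω y + 1 / 2 * y * Ω₁ y + 1 / 5 * (∫ s in (0 : ℝ)..y, hilbertTransform Ω s) * Ω₁ y - hilbertTransform Ω y * Ω y - deriv Ω₁ y)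
              - QFun 8 (1 / 5) δ' δ' y) * v y)) → δ' = δ) ∧
      ∃ (Ωs₁ : ℝ → ℝ) (Hs : ℝ) (hcs : IsCentre 8 (fun y => Ω y + prim (der δ) y) Ωs₁ Hs),
        {σ : ℂ | ra < σ.re ∧ ∃ w : Wcodd 8, w ≠ 0 ∧
          IsWeakEigen eight_pos (-PopC eight_pos 4 (1 / 5) hcs + ((4 : ℝ) • ((innerSL ℝ hR).comp (ιE eight_pos))).smulRight hR)
            (drift (1 / 5) (fun y => Ω y + prim (der δ) y)) (potential 8 4 (fun y => Ω y + prim (der δ) y))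
            ((innerSL ℂ (ofRealW 8 hR)).comp (Wcodd 8).subtypeL) (realOdd hR hh) 4 σ w} = {1} := by
  obtain ⟨δ, ⟨hball, hlin⟩, huniq⟩ := existsUnique_weakSolutionB hc hΩ₁ hC1 S₀ hS₀ f ℓ Nmat hN₁ hN₂ hKNwB hepsNB hG hηB
  exact ⟨δ, hball, hlin, fun δ' h1 h2 => huniq δ' ⟨h1, h2⟩,
    weakEigen_set_eq_singleton_certified hc hΩ₁ hG δ hball hlin hX₀ hR hh hS1 hPD hFD hhw⟩

end Packaged

end SheetRSpectrumCertifiedProfile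
end Summit.NavierStokesRegularity.OSWSelfSimilar

end
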